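/-
COR-CM (cell pub-hodgecm2) — ¬hJ RUSH, HEAD-B (EDITION B): the core's binder `h1 : 𝟙 (A_{K₀}) ≠ 0` SUPPLIED from ONE non-zero
degree-one class on ONE component of ONE tower level (e.g. the tree's own non-zero theta class, ✔ `exists_mem_thetaOf_ne_zero_of_GOG` +
✔ `exists_belowConjThree_mem_thetaOf_ne_zero`), through the SURJECTIVITY half of the displayed print row [Liu2021, Lem. 2.4 (1)]
(`Liu2021.albanese_bettiOne_pullback_bijective`, leaf `Liu2021/Lemma24BettiAlbanese`; R1 file `NotHJAlbStarBijectiveOfLemma24`).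
Pen mukey-p9 (prover-pub-hodgecm2-mukey-p9-g6-0).  THEOREMS ONLY (kernel lane); no `def`, no `sorry`, no `variable`.
FRAMING: HC_CM is NOT proved; «Δ2 BRIDGE CLOSED» is NOT claimed; nothing here asserts hJ, hJ₀, (P-K), R1 or their negations, and NO theta
class is produced here — the non-zero class is a HYPOTHESIS; [Liu2021, Lem. 2.4 (1)] enters ONLY as `(hL : albanese_bettiOne_pullback_bijective)`.
-/
import Summits.HodgeConjecture.CorCM.D2Bridge.NotHJAlbStarBijectiveOfLemma24
import HarnessLib

set_option autoImplicit false

/-!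
# HEAD-B's `h1` from one non-zero class at a tower level, via [Liu2021] Lemma 2.4 (1)

hmusep-p5's core `NotHJ.false_of_records_of_multOne_of_PK` needs ONE level `K₀` with `𝟙 (C.A K₀) ≠ 0` (necessary for any `¬hJ₀`,
desk note `TrivialRecord`).  With R1 for the pin (`bijective_albStarQ_componentAlbanesePin_of_lemma24`, from the print row) this is
the statement «the rational level `levelQ Γ_{K₀}` is non-zero», and THAT follows from a single non-zero class in `H¹` of a single
component surface `P_{Γ_h}` at a single level `Γ ≤ K_f(3)`:

* §1 `exists_ne_zero_of_tmul_ne_zero` — `ℂ ⊗_ℚ M ∋ y ≠ 0 ⇒ ∃ m : M, m ≠ 0` (complex class ⇒ rational class; Mathlib only).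
* §2 `exists_levelQ_ne_zero_of_WQ_ne_zero` — one non-zero RATIONAL class `w ∈ H¹(P_{Γ_{h₀}}(ℂ); ℚ)` extends to a non-zero
  coherent family `c ∈ levelQ Γ` (d2bridge-prove-5's representatives: transport `w` to the representative of `[h₀]`
  (`exists_rel_of_representatives`, `trPullQ_trPullQ`, `trPullQ_one_self`), extend by zero, `evalQ_surjective`).
* §3 `exists_smallLevel_levelOf_eq` — a level `Γ ≤ Level.three` IS a pin level `levelOf V K₀` (`Level.ext`).
* §4 `exists_one_ne_zero_of_lemma24` (explicit §4.2 carrier) and `exists_one_ne_zero_pinTotal_of_lemma24` (TOTAL carrier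
  `Model.sec42DataOf …`, the datum of hJ₀ ∕ the END displays ∕ F-B3's `C`): `∃ K₀, 𝟙 (C.A K₀) ≠ 0` from `c ≠ 0`.
* §5 the same from a non-zero COMPLEX class: on a component (`…_of_W_ne_zero`, `W = ℂ ⊗_ℚ WQ` definitionally) and on the level's own
  surface `X_Γ = P_{Γ_1}` (`…_of_coh_ne_zero`, via ✔ `Level.conj_one`) — the currency of `thetaOf V c k Γ ⊆ U.CohC (U.pms L ι₁ V Γ) 1`.

[Liu2021] Y. Liu, *Fourier–Jacobi cycles and arithmetic relative trace formula*, Camb. J. Math. 9 (2021) = arXiv:2102.11518: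
Lemma 2.4 (1) (FJcycle.tex l. 1210–1228), §4.2 (l. 2053–2074).  [Deligne1979ShimuraVarieties] §2.1.2 (components of `Sh_K(ℂ)`).
-/

noncomputable section

namespace Summit.HodgeConjecture.CorCM.D2Bridge.LevelQReps

open Function CategoryTheory CategoryTheory.Limits AlgebraicGeometry NumberField
open Literature.AlgebraicGeometry.Motives Literature.AlgebraicGeometry.HodgeTheory Literature.AlgebraicGeometry.ShimuraVarieties
open Literature.AlgebraicGeometry.ShimuraVarieties.UnitaryCanonicalModel
open Literature.AlgebraicGeometry.Motives.AbelianVariety (Hom.baseChange)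
open Literature.NumberTheory.Automorphic Literature.NumberTheory.Automorphic.UnitaryGroup Literature.NumberTheory.Automorphic.PicardCM
open Literature.NumberTheory.Automorphic.Liu2021 Literature.NumberTheory.Automorphic.Liu2021.AppendixC
open Literature.NumberTheory.Automorphic.ShimuraDissection
open Literature.NumberTheory.Transcendental (Arapura2012_Cor_15_4_6)
open Summit.HodgeConjecture.CorCM.Model Summit.HodgeConjecture.CorCM.HComp
open HodgeCM HodgeCM.Model HodgeCM.Model.LevelTranslate HodgeCM.Model.TowerLevel HodgeCM.Model.TowerCarrier
open Summit.HodgeConjecture.CorCM.D2Bridge Summit.HodgeConjecture.CorCM.D2Bridge.TowerRational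
open AbelianVariety (bcFunctor)

/-! ## §1 A non-zero complex class has a non-zero rational class behind it -/

/-- **`ℂ ⊗_ℚ M ∋ y ≠ 0 ⇒ M ≠ 0`**: if every element of `M` vanished, every pure tensor `z ⊗ m = z ⊗ 0 = 0` would, hence all of
`ℂ ⊗_ℚ M`. [folklore] -/
theorem exists_ne_zero_of_tmul_ne_zero {M : Type*} [AddCommGroup M] [Module ℚ M] (y : TensorProduct ℚ ℂ M) (hy : y ≠ 0) :
    ∃ m : M, m ≠ 0 := by
  by_contra hM
  push Not at hM
  have key : ∀ t : TensorProduct ℚ ℂ M, t = 0 := fun t => by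
    induction t using TensorProduct.induction_on with
    | zero => rfl
    | tmul z m => rw [hM m, TensorProduct.tmul_zero]
    | add a b ha hb => rw [ha, hb, add_zero]
  exact hy (key y)

/-! ## §2 One non-zero rational class on one component gives a non-zero rational level vector -/

/-- **`H¹(P_{Γ_{h₀}}(ℂ); ℚ) ∋ w ≠ 0 ⇒ levelQ Γ ≠ 0`.**  Transport `w` to the double-coset representative `g q₀` of the class of `h₀`
(`exists_rel_of_representatives`; the transport `t_{γ⁻¹}^*` is injective because `t_γ^* ∘ t_{γ⁻¹}^* = t_1^* = id`,
`trPullQ_trPullQ` + `trPullQ_one_self`), extend by zero to the other representatives, and lift to a coherent family by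
d2bridge-prove-5's `evalQ_surjective`. [cite: Deligne1979ShimuraVarieties, §2.1.2] [cite: Milne2005ShimuraVarieties, Lemma 5.13] -/
theorem exists_levelQ_ne_zero_of_WQ_ne_zero (hHD : exists_isReal_hodgeModel) (hI : hodgePQ_independent_of_hodgeModel)
    (hU : BallQuotientUniformisedDatum) (h₃ : CMAbelianVarietyRealised) (hA : Arapura2012_Cor_15_4_6)
    {L : HodgeCM.CMField} {ι₁ : L →+* ℂ} {V : HodgeCM.HermSpace3 L ι₁} {Γ : HodgeCM.Level V} (hΓ : Γ.BelowConjThree)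
    (h₀ : V.adelicFin) (w : WQ hHD hI hU h₃ Γ hΓ h₀) (hw : w ≠ 0) :
    ∃ c : levelQ hHD hI hU h₃ hA Γ hΓ, c ≠ 0 := by
  classical
  obtain ⟨g, hg⟩ := exists_representatives (ρ V) Γ.K
  obtain ⟨q₀, γ, r⟩ := exists_rel_of_representatives g hg h₀
  -- transport `w` from the index `h₀` to the representative `g q₀`
  have r' : TowerLevel.Rel Γ (1 * γ⁻¹) (g q₀) h₀ := rel_of_rel_rel r (TowerLevel.Rel.refl h₀)
  have hw' : trPullQ hHD hI hU h₃ hA (1 * γ⁻¹) (Γ.conj (g q₀) hΓ) (Γ.conj h₀ hΓ) (transCond_of_rel hΓ r') 1 w ≠ 0 := by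
    intro h0
    apply hw
    have e := trPullQ_trPullQ hHD hI hU h₃ hA (γ₁ := γ) (γ₂ := 1 * γ⁻¹) (γ₃ := 1) (by group)
      (transCond_of_rel hΓ r) (transCond_of_rel hΓ r') (transCond_of_rel hΓ (TowerLevel.Rel.refl h₀)) 1 w
    rw [trPullQ_one_self hHD hI hU h₃ hA _ 1 w, h0, map_zero] at e
    exact e.symm
  obtain ⟨c, hc⟩ := evalQ_surjective hHD hI hU h₃ hA hΓ g (exists_rel_of_representatives g hg)
    (fun _ _ _ r => eq_of_rel_representatives g hg r)
    (Pi.single q₀ (trPullQ hHD hI hU h₃ hA (1 * γ⁻¹) (Γ.conj (g q₀) hΓ) (Γ.conj h₀ hΓ) (transCond_of_rel hΓ r') 1 w))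
  refine ⟨c, fun h0 => hw' ?_⟩
  have h1 := congrFun hc q₀
  rw [h0, map_zero, Pi.zero_apply, Pi.single_eq_same] at h1
  exact h1.symm

/-- The same from a non-zero COMPLEX class `y ∈ H¹(P_{Γ_{h₀}}(ℂ); ℂ) = ℂ ⊗_ℚ H¹(P_{Γ_{h₀}}(ℂ); ℚ)` (`TowerLevel.W = ℂ ⊗ WQ` definitionally;
§1 then `exists_levelQ_ne_zero_of_WQ_ne_zero`). [cite: Deligne1979ShimuraVarieties, §2.1.2] -/
theorem exists_levelQ_ne_zero_of_W_ne_zero (hHD : exists_isReal_hodgeModel) (hI : hodgePQ_independent_of_hodgeModel)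
    (hU : BallQuotientUniformisedDatum) (h₃ : CMAbelianVarietyRealised) (hA : Arapura2012_Cor_15_4_6)
    {L : HodgeCM.CMField} {ι₁ : L →+* ℂ} {V : HodgeCM.HermSpace3 L ι₁} {Γ : HodgeCM.Level V} (hΓ : Γ.BelowConjThree)
    (h₀ : V.adelicFin) (y : W hHD hI hU h₃ Γ hΓ h₀) (hy : y ≠ 0) :
    ∃ c : levelQ hHD hI hU h₃ hA Γ hΓ, c ≠ 0 := by
  obtain ⟨w, hw⟩ := exists_ne_zero_of_tmul_ne_zero (M := WQ hHD hI hU h₃ Γ hΓ h₀) y hy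
  exact exists_levelQ_ne_zero_of_WQ_ne_zero hHD hI hU h₃ hA hΓ h₀ w hw

/-! ## §3 A level below `K_f(3)` is a pin level -/

/-- **`Γ ≤ Level.three V` ⇒ `Γ = levelOf V K₀`** for the small level `K₀ := (Γ.K ≤ K_f(3𝓞_L))` (a `HodgeCM.Level` is determined by
its compact open, `Level.ext`; `(levelOf V K₀).K = K₀` by `rfl`). [cite: Liu2021, Prop. C.5 l. 4627–4628] -/
theorem exists_smallLevel_levelOf_eq {L : HodgeCM.CMField} {ι₁ : L →+* ℂ} (V : HodgeCM.HermSpace3 L ι₁)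
    {Γ : HodgeCM.Level V} (hΓ3 : Γ ≤ HodgeCM.Level.three V) :
    ∃ K₀ : C5.SmallLevel (K3 (pkgV V)), levelOf V K₀ = Γ :=
  ⟨⟨⟨Γ.K, Γ.isOpen_K, Γ.isCompact_K⟩, HodgeCM.Level.le_def.mp hΓ3⟩, HodgeCM.Level.ext rfl⟩

/-! ## §4 `∃ K₀, 𝟙 (A_{K₀}) ≠ 0` from a non-zero rational level vector -/

/-- **`h1` at Liu's explicit §4.2 carrier**: a non-zero `c ∈ levelQ Γ` at a level `Γ ≤ K_f(3)` gives a level `K₀` (namely `Γ` itself,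
§3) with `𝟙 (A_{K₀}) ≠ 0` — `c = J^*_{K₀} x` by the SURJECTIVITY half of [Liu2021, Lem. 2.4 (1)] for the pin
(`bijective_albStarQ_componentAlbanesePin_of_lemma24`), `x ≠ 0`, then `one_ne_zero_of_exists_betti_ne_zero'`.
[cite: Liu2021, Lemma 2.4 (1) (FJcycle.tex l. 1210–1228)] -/
theorem exists_one_ne_zero_of_lemma24 (hL : albanese_bettiOne_pullback_bijective)
    {L : HodgeCM.CMField} {ι₁ : L →+* ℂ} (V : HodgeCM.HermSpace3 L ι₁)
    (hU : BallQuotientUniformisedDatum) (h₃ : CMAbelianVarietyRealised) (h4 : 4 ≤ Module.finrank ℚ L)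
    (h : exists_recordSystem) (hHD : exists_isReal_hodgeModel) [Algebra L ℂ] (hι : (algebraMap L ℂ).comp (cmConjRingHom L) = ι₁)
    (hI : hodgePQ_independent_of_hodgeModel) (hA : Arapura2012_Cor_15_4_6) (hU7 : heckeTranslate_definedOver)
    (Φ : CMType (pkgF L)) (iso : ℕ → Prop)
    {Γ : HodgeCM.Level V} (hΓ3 : Γ ≤ HodgeCM.Level.three V) (hΓ : Γ.BelowConjThree)
    (c : levelQ hHD hI hU h₃ hA Γ hΓ) (hc : c ≠ 0) :
    ∃ K₀ : C5.SmallLevel (K3 (pkgV V)), (𝟙 ((sec42DataOfFourLe h (pkgV V) Φ h4 iso).A K₀) : _ ⟶ _) ≠ 0 := by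
  obtain ⟨K₀, rfl⟩ := exists_smallLevel_levelOf_eq V hΓ3
  refine ⟨K₀, ?_⟩
  obtain ⟨x, rfl⟩ := (bijective_albStarQ_componentAlbanesePin_of_lemma24 hL V hU h₃ h4 h hHD hι hI hA hU7 Φ iso K₀).2 c
  -- (`exact`, not `rw`: the pin's level dictionary `Γof K₀` is `levelOf V K₀` only after unfolding `componentAlbanesePin`)
  exact one_ne_zero_of_exists_betti_ne_zero' _ ⟨x, fun h0 => hc (by rw [h0]; exact map_zero _)⟩

/-- **`h1` at the TOTAL carrier** (`Model.sec42DataOf …` — the `C` of hJ₀, of the END displays and of HEAD-B's core): transport of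
`exists_one_ne_zero_of_lemma24` along ✔ `sec42DataOf_eq_of_four_le`. [cite: Liu2021, §4.2 l. 2053–2074, Lemma 2.4 (1)] -/
theorem exists_one_ne_zero_pinTotal_of_lemma24 (hL : albanese_bettiOne_pullback_bijective)
    {L : HodgeCM.CMField} {ι₁ : L →+* ℂ} (V : HodgeCM.HermSpace3 L ι₁)
    (hU : BallQuotientUniformisedDatum) (h₃ : CMAbelianVarietyRealised) (h4 : 4 ≤ Module.finrank ℚ L)
    (h : exists_recordSystem) (hHD : exists_isReal_hodgeModel) [Algebra L ℂ] (hι : (algebraMap L ℂ).comp (cmConjRingHom L) = ι₁)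
    (hI : hodgePQ_independent_of_hodgeModel) (hA : Arapura2012_Cor_15_4_6) (hU7 : heckeTranslate_definedOver)
    (Φ : CMType (pkgF L))
    (isoF : ∀ (F : Summit.HodgeConjecture.CorCM.CMField) (ι : F →+* ℂ) (_ : Summit.HodgeConjecture.CorCM.HermSpace3 F ι)
      (_ : CMType F), ℕ → Prop)
    {Γ : HodgeCM.Level V} (hΓ3 : Γ ≤ HodgeCM.Level.three V) (hΓ : Γ.BelowConjThree)
    (c : levelQ hHD hI hU h₃ hA Γ hΓ) (hc : c ≠ 0) :
    ∃ K₀ : C5.SmallLevel (sec42DataOf h isoF (pkgF L) ι₁ (pkgV V) Φ).S.K₀,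
      (𝟙 ((sec42DataOf h isoF (pkgF L) ι₁ (pkgV V) Φ).A K₀) : _ ⟶ _) ≠ 0 := by
  rw [sec42DataOf_eq_of_four_le h (pkgV V) Φ isoF h4]
  exact exists_one_ne_zero_of_lemma24 hL V hU h₃ h4 h hHD hι hI hA hU7 Φ (isoF (pkgF L) ι₁ (pkgV V) Φ) hΓ3 hΓ c hc

/-! ## §5 … from one non-zero COMPLEX class (the theta currency) -/

/-- **`h1` from one non-zero complex class on one component** `y ∈ H¹(P_{Γ_{h₀}}(ℂ); ℂ)` of one level `Γ ≤ K_f(3)` (§1 + §2 + §4).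
[cite: Liu2021, Lemma 2.4 (1) (FJcycle.tex l. 1210–1228)] [cite: Deligne1979ShimuraVarieties, §2.1.2] -/
theorem exists_one_ne_zero_pinTotal_of_lemma24_of_W_ne_zero (hL : albanese_bettiOne_pullback_bijective)
    {L : HodgeCM.CMField} {ι₁ : L →+* ℂ} (V : HodgeCM.HermSpace3 L ι₁)
    (hU : BallQuotientUniformisedDatum) (h₃ : CMAbelianVarietyRealised) (h4 : 4 ≤ Module.finrank ℚ L)
    (h : exists_recordSystem) (hHD : exists_isReal_hodgeModel) [Algebra L ℂ] (hι : (algebraMap L ℂ).comp (cmConjRingHom L) = ι₁)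
    (hI : hodgePQ_independent_of_hodgeModel) (hA : Arapura2012_Cor_15_4_6) (hU7 : heckeTranslate_definedOver)
    (Φ : CMType (pkgF L))
    (isoF : ∀ (F : Summit.HodgeConjecture.CorCM.CMField) (ι : F →+* ℂ) (_ : Summit.HodgeConjecture.CorCM.HermSpace3 F ι)
      (_ : CMType F), ℕ → Prop)
    {Γ : HodgeCM.Level V} (hΓ3 : Γ ≤ HodgeCM.Level.three V) (hΓ : Γ.BelowConjThree)
    (h₀ : V.adelicFin) (y : W hHD hI hU h₃ Γ hΓ h₀) (hy : y ≠ 0) :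
    ∃ K₀ : C5.SmallLevel (sec42DataOf h isoF (pkgF L) ι₁ (pkgV V) Φ).S.K₀,
      (𝟙 ((sec42DataOf h isoF (pkgF L) ι₁ (pkgV V) Φ).A K₀) : _ ⟶ _) ≠ 0 := by
  obtain ⟨c, hc⟩ := exists_levelQ_ne_zero_of_W_ne_zero hHD hI hU h₃ hA hΓ h₀ y hy
  exact exists_one_ne_zero_pinTotal_of_lemma24 hL V hU h₃ h4 h hHD hι hI hA hU7 Φ isoF hΓ3 hΓ c hc

/-- **`h1` from one non-zero complex class of the level's own surface** `ω ∈ H¹(X_Γ(ℂ); ℂ) = U.CohC (U.pms L ι₁ V Γ) 1` — the currency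
of the pinned theta sets `thetaOf V c k Γ` — at one level `Γ ≤ K_f(3)`: `X_Γ = P_{Γ_1}` (✔ `Level.conj_one`), then
`exists_one_ne_zero_pinTotal_of_lemma24_of_W_ne_zero` at the index `h₀ := 1`.  So «∃ Γ ≤ K_f(3), ∃ ω ∈ Θ_k(Γ), ω ≠ 0» feeds HEAD-B's
`h1` through the print row [Liu2021, Lem. 2.4 (1)] alone. [cite: Liu2021, Lemma 2.4 (1) (FJcycle.tex l. 1210–1228)]
[cite: Deligne1979ShimuraVarieties, §2.1.2] -/
theorem exists_one_ne_zero_pinTotal_of_lemma24_of_coh_ne_zero (hL : albanese_bettiOne_pullback_bijective)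
    {L : HodgeCM.CMField} {ι₁ : L →+* ℂ} (V : HodgeCM.HermSpace3 L ι₁)
    (hU : BallQuotientUniformisedDatum) (h₃ : CMAbelianVarietyRealised) (h4 : 4 ≤ Module.finrank ℚ L)
    (h : exists_recordSystem) (hHD : exists_isReal_hodgeModel) [Algebra L ℂ] (hι : (algebraMap L ℂ).comp (cmConjRingHom L) = ι₁)
    (hI : hodgePQ_independent_of_hodgeModel) (hA : Arapura2012_Cor_15_4_6) (hU7 : heckeTranslate_definedOver)
    (Φ : CMType (pkgF L))
    (isoF : ∀ (F : Summit.HodgeConjecture.CorCM.CMField) (ι : F →+* ℂ) (_ : Summit.HodgeConjecture.CorCM.HermSpace3 F ι)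
      (_ : CMType F), ℕ → Prop)
    {Γ : HodgeCM.Level V} (hΓ3 : Γ ≤ HodgeCM.Level.three V) (hΓ : Γ.BelowConjThree)
    (ω : Coh hHD hI hU h₃ Γ 1) (hω : ω ≠ 0) :
    ∃ K₀ : C5.SmallLevel (sec42DataOf h isoF (pkgF L) ι₁ (pkgV V) Φ).S.K₀,
      (𝟙 ((sec42DataOf h isoF (pkgF L) ι₁ (pkgV V) Φ).A K₀) : _ ⟶ _) ≠ 0 := by
  have key : ∀ (Δ : HodgeCM.Level V) (_ : Δ = Γ.conj 1 hΓ) (ω' : Coh hHD hI hU h₃ Δ 1), ω' ≠ 0 →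
      ∃ K₀ : C5.SmallLevel (sec42DataOf h isoF (pkgF L) ι₁ (pkgV V) Φ).S.K₀,
        (𝟙 ((sec42DataOf h isoF (pkgF L) ι₁ (pkgV V) Φ).A K₀) : _ ⟶ _) ≠ 0 := by
    intro Δ e ω' hω'
    subst e
    exact exists_one_ne_zero_pinTotal_of_lemma24_of_W_ne_zero hL V hU h₃ h4 h hHD hι hI hA hU7 Φ isoF hΓ3 hΓ 1 ω' hω'
  exact key Γ (HodgeCM.Level.conj_one Γ hΓ).symm ω hω

end Summit.HodgeConjecture.CorCM.D2Bridge.LevelQReps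

end
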